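import Mathlib
import Summits.NavierStokesRegularity.NavierStokesRegularity.Theorems.LerayQuarterDissipationFiniteDissipationLiouvilleTrappingMixed
import Summits.NavierStokesRegularity.NavierStokesRegularity.Theorems.LerayQuarterDissipationFiniteDissipationLiouvilleEveryInstant
import HarnessLib

/-!
# Crux `FiniteDissipationLiouville` (stmt-NavierStokesRegularity-22144): THE LENS-SHAPED EVERY-INSTANT
# ENSTROPHY FLOOR — at every instant the pair `(C, K_S⁶(√(−t)∫‖ω‖²)²)` of the singular profile lies
# outside the mixed lens; for `C ≤ 1` the dimensionless enstrophy is `≥ 2/K_S³`, not `(64/27)^{1/2}/K_S³`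

Theorems file of route `LerayQuarterDissipation` (lead prover g17; `--supports` the crux; sequel of
`…TrappingMixed` and `…EveryInstant`). Navier–Stokes regularity is NOT proved by anything here; no
summit is.

`𝒟_{C,K}`: Type-I ancient mild fields (KNSS gauge, constant `C`) with Leray's quarter-rate law
`∫‖DV(t)‖² ≤ K/√(−t)`; `Z(s) = ∫‖Ω(s)‖² = √(−t)∫‖curl V(t)‖²dx`; `K_S` Mathlib's
Gagliardo–Nirenberg–Sobolev constant; admissible weights: `0 ≤ λ ≤ 1`, `μ, κ, δ > 0` with
`2λμ + (1−λ)·3(1+δ)/(2κ) ≤ 2`.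

* `law_from_of_trapping_mixed` — one instant inside the lens ⇒ the law holds with the smaller
  constant `Z(s₀)` from that instant on (`…TrappingMixed.trapping_mixed_exp`);
* `notSingular_of_lens_along_scales` — ns-lqd-p1's sub-threshold leaf with the MIXED rung
  `…MixedRegion.eq_zero_of_mixed` as the gap (the orbit limit keeps the Type-I constant `C`);
* **`not_singular_of_lens_instant`** — ONE instant with `(C, Z(s₀))` in the lens forces regularity;
* **`lens_floor_of_singular` / `vorticity_lens_floor_of_singular`** — a SINGULAR member has, at EVERY
  instant and for all admissible weights, `λC²/μ + (1−λ)κ³·max(K_S⁶(√(−t)∫‖ω(t)‖²)², 1) ≥ 1`;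
* **`vorticity_floor_four_of_singular_of_typeI_le_one`** — in particular **for `C ≤ 1`:
  `K_S⁶(√(−t)∫‖ω(t)‖²dx)² ≥ 4` at EVERY instant** (the pure floor of `…EveryInstant` is `64/27`),
  by the closed-form weights of `…MixedRegionExplicit` (`κ = ½`, `λ = 1 − g/8`, `δ = g/6`).

HONEST FRAMING. Explicit necessary conditions on a HYPOTHETICAL object (Mathlib's non-sharp `K_S`;
the orbit-limit/persistence step is qualitative but enters no constant). Nothing is removed from the
catalogued DSS wall (`∀ c > 1, TypeIDSSLiouville c`, NECESSARY for the crux); verdict of the line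
unchanged (FRONTIER). Nothing here bears on Navier–Stokes regularity or blow-up.

References: J. Leray, Acta Math. 63 (1934) §§19–20; Robinson–Rodrigo–Sadowski (2016) Lemma 6.11,
Thm 6.12; Koch–Nadirashvili–Seregin–Šverák, Acta Math. 203 (2009) §§4, 6; Albritton–Barker,
arXiv:1811.00502, Prop. 2.3.
-/

noncomputable section

set_option linter.dupNamespace false

namespace Summit.NavierStokesRegularity.NavierStokesRegularity.Theorems.FiniteDissipationLiouville.EveryInstantMixed

open MeasureTheory Set Filter Topology Metric InnerProductSpace Function Real
open scoped RealInnerProductSpace ContDiff ENNReal Laplacian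
open Literature.Analysis Literature.Analysis.FluidPDE
open Summit.NavierStokesRegularity.NavierStokesRegularity.Theorems
open Summit.NavierStokesRegularity.NavierStokesRegularity.Theorems.GaussianGap
open Summit.NavierStokesRegularity.NavierStokesRegularity.Theorems.SimilarityEnstrophy
open Summit.NavierStokesRegularity.NavierStokesRegularity.Theorems.SmallDissipationGap
open Summit.NavierStokesRegularity.NavierStokesRegularity.Theorems.FiniteDissipationLiouville.Trapping
open Summit.NavierStokesRegularity.NavierStokesRegularity.Theorems.FiniteDissipationLiouville.TrappingMixed
open Summit.NavierStokesRegularity.NavierStokesRegularity.Theorems.FiniteDissipationLiouville.EveryInstant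

variable {C : ℝ} {V : ℝ → (EuclideanSpace ℝ (Fin 3)) → (EuclideanSpace ℝ (Fin 3))}

section Lens

/-- **Physical reading of the lens trapping.** If at the instant `s₀` the pair `(C, Z(s₀))` lies in
the lens (admissible weights, `λC²/μ + (1−λ)κ³·max((√Z(s₀)(√K_S)³)⁴,1) < 1`), then
`∫⁻‖DV(t)‖ₑ² ≤ Z(s₀)/√(−t)` for all `−e^{−s₀} ≤ t < 0`. [folklore energy method] -/
theorem law_from_of_trapping_mixed (hV : IsTypeIAncientMild C V) {K : ℝ}
    (hK : ∀ t : ℝ, t < 0 → ∫⁻ x, ‖fderiv ℝ (V t) x‖ₑ ^ 2 ≤ ENNReal.ofReal (K / Real.sqrt (-t)))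
    {s₀ lam μ κ δ : ℝ} (hlam0 : 0 ≤ lam) (hlam1 : lam ≤ 1) (hμ : 0 < μ) (hκ : 0 < κ) (hδ : 0 < δ)
    (H1 : 2 * lam * μ + (1 - lam) * (3 * (1 + δ) / (2 * κ)) ≤ 2)
    (H2 : lam * C ^ 2 / μ + (1 - lam) * κ ^ 3 *
      (max ((Real.sqrt (∫ y, ‖lerayVorticity V s₀ y‖ ^ 2) * Real.sqrt (SNormLESNormFDerivOfEqConst (EuclideanSpace ℝ (Fin 3))
        (volume : Measure (EuclideanSpace ℝ (Fin 3))) 2 : ℝ) ^ 3) ^ 4) 1) < 1) :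
    ∀ t : ℝ, -Real.exp (-s₀) ≤ t → t < 0 →
      ∫⁻ x, ‖fderiv ℝ (V t) x‖ₑ ^ 2 ≤
        ENNReal.ofReal ((∫ y, ‖lerayVorticity V s₀ y‖ ^ 2) / Real.sqrt (-t)) := by
  obtain ⟨r, hr, htrap⟩ := trapping_mixed_exp hV hK hlam0 hlam1 hμ hκ hδ H1 H2
  intro t ht₀ ht
  set s : ℝ := -Real.log (-t) with hs
  have hts : -Real.exp (-s) = t := by rw [hs, neg_neg, Real.exp_log (neg_pos.2 ht), neg_neg]
  have hs₀ : s₀ ≤ s := by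
    rw [hs, le_neg, ← Real.exp_le_exp, Real.exp_log (neg_pos.2 ht)]
    linarith
  have hZ : ∫ y, ‖lerayVorticity V s y‖ ^ 2 ≤ ∫ y, ‖lerayVorticity V s₀ y‖ ^ 2 := by
    refine (htrap s hs₀).trans (mul_le_of_le_one_left (integral_nonneg fun y => sq_nonneg _) ?_)
    rw [Real.exp_le_one_iff, neg_mul, neg_nonpos]
    exact mul_nonneg hr.le (by linarith)
  have hDU := integrable_sq_norm_fderiv_lerayOrbit hV hK s
  have hle := (VorticityAmplitude.integral_sq_norm_fderiv_lerayOrbit_le hV hK s).trans hZ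
  have h := lintegral_fderiv_sq_le_of_lerayOrbit V hDU.1 hle
  rwa [hts] at h

/-- **The sub-threshold leaf along scales, MIXED rung.** If a member of `𝒟_{C,K}` admits scales
`l_k > 0` along which `√(−l_k²s)∫‖∇u(l_k²s)‖² ≤ K₁` eventually (every fixed `s < 0`), and `(C, K₁)`
lies in the lens (admissible weights, `λC²/μ + (1−λ)κ³θ(K₁)⁴ < 1`), then it is bounded on some
backward cylinder at the origin: the orbit limit is a member of `𝒟_{C,K₁}` (same `C`), hence
vanishes by `…MixedRegion.eq_zero_of_mixed`, while singularities persist. [folklore energy method] -/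
theorem notSingular_of_lens_along_scales {C K K₁ : ℝ}
    {u : ℝ → EuclideanSpace ℝ (Fin 3) → EuclideanSpace ℝ (Fin 3)}
    {lam μ κ δ : ℝ} (hlam0 : 0 ≤ lam) (hlam1 : lam ≤ 1) (hμ : 0 < μ) (hκ : 0 < κ) (hδ : 0 < δ)
    (H1 : 2 * lam * μ + (1 - lam) * (3 * (1 + δ) / (2 * κ)) ≤ 2)
    (H2 : lam * C ^ 2 / μ + (1 - lam) * κ ^ 3 *
      (Real.sqrt (max K₁ 0) * Real.sqrt (SNormLESNormFDerivOfEqConst (EuclideanSpace ℝ (Fin 3))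
        (volume : Measure (EuclideanSpace ℝ (Fin 3))) 2 : ℝ) ^ 3) ^ 4 < 1)
    (hu : IsTypeIAncientMild C u)
    (hlaw : ∀ s : ℝ, s < 0 → ∫⁻ x, ‖fderiv ℝ (u s) x‖ₑ ^ 2 ≤ ENNReal.ofReal (K / Real.sqrt (-s)))
    (hsc : ∃ l : ℕ → ℝ, (∀ k, 0 < l k) ∧ ∀ s : ℝ, s < 0 → ∀ᶠ k in atTop,
        ∫⁻ x, ‖fderiv ℝ (u (l k ^ 2 * s)) x‖ₑ ^ 2 ≤
          ENNReal.ofReal (K₁ / Real.sqrt (-(l k ^ 2 * s)))) :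
    ¬ (∀ r > 0, ∀ M : ℝ, ∃ t ∈ Set.Ioo (-(r ^ 2)) (0 : ℝ),
        ∃ x ∈ Metric.ball (0 : EuclideanSpace ℝ (Fin 3)) r, M < ‖u t x‖) := by
  obtain ⟨l, hl, hwin⟩ := hsc
  intro hsing
  have hwin' : ∀ s : ℝ, s < 0 → ∀ᶠ k in atTop,
      ∫⁻ x, ‖fderiv ℝ (nsRescale (l k) u s) x‖ₑ ^ 2 ≤ ENNReal.ofReal (K₁ / Real.sqrt (-s)) :=
    fun s hs => (hwin s hs).mono fun k hk => Subthreshold.law_nsRescale_of_law_at (hl k) hs hk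
  obtain ⟨ψ, -, W, hW, hlawW, hunif, -⟩ :=
    Subthreshold.exists_orbitLimit_of_eventually_law hu hlaw l hl hwin'
  have hz : ∀ t < 0, ∀ x, W t x = 0 :=
    MixedRegion.eq_zero_of_mixed hW hlawW le_rfl hlam0 hlam1 hμ hκ hδ H1 H2
  have hWsing := RecurrentReductionD.persistent_singularity hu hlaw hsing (fun j => l (ψ j))
    (fun j => hl _) W hunif
  obtain ⟨t, ht, x, -, hM⟩ := hWsing 1 one_pos 0
  rw [hz t ht.2 x, norm_zero] at hM
  exact lt_irrefl 0 hM

/-- **ONE INSTANT INSIDE THE LENS FORCES REGULARITY.** A member of `𝒟_{C,K}` whose global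
similarity enstrophy at ONE instant `s₀` puts `(C, Z(s₀))` in the lens — admissible weights with
`λC²/μ + (1−λ)κ³·max((√Z(s₀)(√K_S)³)⁴,1) < 1` — is bounded on some backward cylinder at the origin.
[folklore energy method] -/
theorem not_singular_of_lens_instant (hV : IsTypeIAncientMild C V) {K : ℝ}
    (hK : ∀ t : ℝ, t < 0 → ∫⁻ x, ‖fderiv ℝ (V t) x‖ₑ ^ 2 ≤ ENNReal.ofReal (K / Real.sqrt (-t)))
    {s₀ lam μ κ δ : ℝ} (hlam0 : 0 ≤ lam) (hlam1 : lam ≤ 1) (hμ : 0 < μ) (hκ : 0 < κ) (hδ : 0 < δ)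
    (H1 : 2 * lam * μ + (1 - lam) * (3 * (1 + δ) / (2 * κ)) ≤ 2)
    (H2 : lam * C ^ 2 / μ + (1 - lam) * κ ^ 3 *
      (max ((Real.sqrt (∫ y, ‖lerayVorticity V s₀ y‖ ^ 2) * Real.sqrt (SNormLESNormFDerivOfEqConst (EuclideanSpace ℝ (Fin 3))
        (volume : Measure (EuclideanSpace ℝ (Fin 3))) 2 : ℝ) ^ 3) ^ 4) 1) < 1) :
    ¬ (∀ r > 0, ∀ M : ℝ, ∃ t ∈ Set.Ioo (-(r ^ 2)) (0 : ℝ),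
        ∃ x ∈ Metric.ball (0 : EuclideanSpace ℝ (Fin 3)) r, M < ‖V t x‖) := by
  set z₀ : ℝ := ∫ y, ‖lerayVorticity V s₀ y‖ ^ 2 with hz₀
  have hz0 : 0 ≤ z₀ := integral_nonneg fun y => sq_nonneg _
  have hlaw := law_from_of_trapping_mixed hV hK hlam0 hlam1 hμ hκ hδ H1 H2
  have H2' : lam * C ^ 2 / μ + (1 - lam) * κ ^ 3 *
      (Real.sqrt (max z₀ 0) * Real.sqrt (SNormLESNormFDerivOfEqConst (EuclideanSpace ℝ (Fin 3))
        (volume : Measure (EuclideanSpace ℝ (Fin 3))) 2 : ℝ) ^ 3) ^ 4 < 1 := by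
    rw [max_eq_left hz0]
    have hle : (Real.sqrt z₀ * Real.sqrt (SNormLESNormFDerivOfEqConst (EuclideanSpace ℝ (Fin 3))
        (volume : Measure (EuclideanSpace ℝ (Fin 3))) 2 : ℝ) ^ 3) ^ 4 ≤
        max ((Real.sqrt z₀ * Real.sqrt (SNormLESNormFDerivOfEqConst (EuclideanSpace ℝ (Fin 3))
        (volume : Measure (EuclideanSpace ℝ (Fin 3))) 2 : ℝ) ^ 3) ^ 4) 1 := le_max_left _ _
    have h1lam : 0 ≤ (1 - lam) * κ ^ 3 := by
      have : 0 ≤ 1 - lam := by linarith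
      positivity
    nlinarith only [H2, hle, h1lam]
  refine notSingular_of_lens_along_scales (K₁ := z₀) hlam0 hlam1 hμ hκ hδ H1 H2' hV hK
    ⟨fun k => 1 / ((k : ℝ) + 1), fun k => by positivity, ?_⟩
  intro s hs
  have hT : Tendsto (fun k : ℕ => (1 / ((k : ℝ) + 1)) ^ 2 * s) atTop (𝓝 (0 * s)) := by
    refine Tendsto.mul_const s ?_
    have h := (tendsto_one_div_add_atTop_nhds_zero_nat (𝕜 := ℝ)).pow 2
    simpa using h
  rw [zero_mul] at hT
  have hev : ∀ᶠ k : ℕ in atTop, -Real.exp (-s₀) < (1 / ((k : ℝ) + 1)) ^ 2 * s :=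
    hT.eventually (eventually_gt_nhds (neg_neg_of_pos (Real.exp_pos _)))
  filter_upwards [hev] with k hk
  have hneg : (1 / ((k : ℝ) + 1)) ^ 2 * s < 0 := mul_neg_of_pos_of_neg (by positivity) hs
  exact hlaw _ hk.le hneg

/-- **THE LENS-SHAPED EVERY-INSTANT FLOOR (similarity variables).** A SINGULAR member of `𝒟_{C,K}`
has, at EVERY instant `s` and for all admissible weights,
`λC²/μ + (1−λ)κ³·max((√Z(s)(√K_S)³)⁴,1) ≥ 1`. [folklore energy method] -/
theorem lens_floor_of_singular (hV : IsTypeIAncientMild C V) {K : ℝ}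
    (hK : ∀ t : ℝ, t < 0 → ∫⁻ x, ‖fderiv ℝ (V t) x‖ₑ ^ 2 ≤ ENNReal.ofReal (K / Real.sqrt (-t)))
    (hsing : ∀ r > 0, ∀ M : ℝ, ∃ t ∈ Set.Ioo (-(r ^ 2)) (0 : ℝ),
        ∃ x ∈ Metric.ball (0 : EuclideanSpace ℝ (Fin 3)) r, M < ‖V t x‖)
    {lam μ κ δ : ℝ} (hlam0 : 0 ≤ lam) (hlam1 : lam ≤ 1) (hμ : 0 < μ) (hκ : 0 < κ) (hδ : 0 < δ)
    (H1 : 2 * lam * μ + (1 - lam) * (3 * (1 + δ) / (2 * κ)) ≤ 2) (s : ℝ) :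
    1 ≤ lam * C ^ 2 / μ + (1 - lam) * κ ^ 3 *
      (max ((Real.sqrt (∫ y, ‖lerayVorticity V s y‖ ^ 2) * Real.sqrt (SNormLESNormFDerivOfEqConst (EuclideanSpace ℝ (Fin 3))
        (volume : Measure (EuclideanSpace ℝ (Fin 3))) 2 : ℝ) ^ 3) ^ 4) 1) := by
  by_contra h
  push Not at h
  exact not_singular_of_lens_instant hV hK hlam0 hlam1 hμ hκ hδ H1 h hsing

/-- **THE LENS-SHAPED EVERY-INSTANT FLOOR, physical variables.** A SINGULAR member of `𝒟_{C,K}` has,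
at EVERY instant `t < 0` and for all admissible weights,
`λC²/μ + (1−λ)κ³·max((√(√(−t)∫‖curl V(t)‖²dx)(√K_S)³)⁴,1) ≥ 1`. [folklore energy method] -/
theorem vorticity_lens_floor_of_singular (hV : IsTypeIAncientMild C V) {K : ℝ}
    (hK : ∀ t : ℝ, t < 0 → ∫⁻ x, ‖fderiv ℝ (V t) x‖ₑ ^ 2 ≤ ENNReal.ofReal (K / Real.sqrt (-t)))
    (hsing : ∀ r > 0, ∀ M : ℝ, ∃ t ∈ Set.Ioo (-(r ^ 2)) (0 : ℝ),
        ∃ x ∈ Metric.ball (0 : EuclideanSpace ℝ (Fin 3)) r, M < ‖V t x‖)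
    {lam μ κ δ : ℝ} (hlam0 : 0 ≤ lam) (hlam1 : lam ≤ 1) (hμ : 0 < μ) (hκ : 0 < κ) (hδ : 0 < δ)
    (H1 : 2 * lam * μ + (1 - lam) * (3 * (1 + δ) / (2 * κ)) ≤ 2) {t : ℝ} (ht : t < 0) :
    1 ≤ lam * C ^ 2 / μ + (1 - lam) * κ ^ 3 *
      (max ((Real.sqrt (Real.sqrt (-t) * ∫ x, ‖curl (V t) x‖ ^ 2) * Real.sqrt (SNormLESNormFDerivOfEqConst (EuclideanSpace ℝ (Fin 3))
        (volume : Measure (EuclideanSpace ℝ (Fin 3))) 2 : ℝ) ^ 3) ^ 4) 1) := by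
  set s : ℝ := -Real.log (-t) with hs
  have hts : -Real.exp (-s) = t := by rw [hs, neg_neg, Real.exp_log (neg_pos.2 ht), neg_neg]
  have hsq : Real.exp (-s / 2) = Real.sqrt (-t) := by rw [← sqrt_exp_neg, ← neg_neg (Real.exp _), hts]
  have h := lens_floor_of_singular hV hK hsing hlam0 hlam1 hμ hκ hδ H1 s
  rwa [integral_sq_norm_lerayVorticity_eq, hts, hsq] at h

/-- Closed-form admissible weights at `C ≤ 1` for a target `T < 4` (`κ = ½`, `λ = 1 − g/8`,
`δ = g/6`, `μ = (2 − 3(g/8)(1+δ))/(2(1−g/8))`, `g = 1 − T/4`; as in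
`…MixedRegionExplicit.eq_zero_of_typeI_le_one_of_theta_four_lt_four`). [folklore] -/
theorem exists_lens_weights_of_le_one (hC0 : 0 ≤ C) (hC1 : C ≤ 1) {T : ℝ} (hT0 : 0 ≤ T)
    (hT : T < 4) :
    ∃ lam μ κ δ : ℝ, 0 ≤ lam ∧ lam ≤ 1 ∧ 0 < μ ∧ 0 < κ ∧ 0 < δ ∧
      2 * lam * μ + (1 - lam) * (3 * (1 + δ) / (2 * κ)) ≤ 2 ∧
      lam * C ^ 2 / μ + (1 - lam) * κ ^ 3 * T < 1 := by
  set g : ℝ := 1 - T / 4 with hg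
  have hgpos : 0 < g := by rw [hg]; linarith
  have hg1 : g ≤ 1 := by rw [hg]; linarith
  set ε : ℝ := g / 8 with hε
  set δ : ℝ := g / 6 with hδ
  have hεpos : 0 < ε := by positivity
  have hδpos : 0 < δ := by positivity
  have hε1 : ε ≤ 1 / 8 := by rw [hε]; linarith
  set p : ℝ := 3 * ε * (1 + δ) with hp
  have hppos : 0 < p := by positivity
  have hp1 : p ≤ 7 / 16 := by
    rw [hp]
    have : (1 + δ) ≤ 7 / 6 := by rw [hδ]; linarith
    nlinarith
  set μ : ℝ := (2 - p) / (2 * (1 - ε)) with hμ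
  have h1ε : 0 < 1 - ε := by linarith
  have hμpos : 0 < μ := by rw [hμ]; exact div_pos (by linarith) (by linarith)
  refine ⟨1 - ε, μ, 1 / 2, δ, by linarith, by linarith, hμpos, by norm_num, hδpos, ?_, ?_⟩
  · have e : 2 * (1 - ε) * μ + (1 - (1 - ε)) * (3 * (1 + δ) / (2 * (1 / 2))) = 2 := by
      rw [hμ, hp]; field_simp; ring
    rw [e]
  · have hC2 : C ^ 2 ≤ 1 := by nlinarith
    have hq : (1 - ε) * C ^ 2 / μ ≤ (1 - ε) / μ := by
      rw [mul_div_assoc]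
      calc (1 - ε) * (C ^ 2 / μ) ≤ (1 - ε) * (1 / μ) := by
            refine mul_le_mul_of_nonneg_left ?_ h1ε.le
            exact div_le_div_of_nonneg_right hC2 hμpos.le
        _ = (1 - ε) / μ := by ring
    have e1 : (1 - ε) / μ = 2 * (1 - ε) ^ 2 / (2 - p) := by
      rw [hμ]; field_simp
    have e2 : (1 - (1 - ε)) * (1 / 2) ^ 3 * T = ε * T / 8 := by ring
    rw [e2]
    have h2p : 0 < 2 - p := by linarith
    have hkey : 2 * (1 - ε) ^ 2 / (2 - p) + ε * T / 8 < 1 := by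
      rw [div_add' _ _ _ h2p.ne', div_lt_one h2p]
      have hTp : 0 ≤ T * p := by positivity
      have hlin : T / 4 - 1 + 3 * δ + 2 * ε - T * p / 8 < 0 := by
        rw [hδ, hε, hg]
        nlinarith
      have hexp : 2 * (1 - ε) ^ 2 + ε * T / 8 * (2 - p) - (2 - p) =
          ε * (T / 4 - 1 + 3 * δ + 2 * ε - T * p / 8) := by
        rw [hp]; ring
      have := mul_neg_of_pos_of_neg hεpos hlin
      linarith
    linarith [hq, e1 ▸ hkey]

/-- **FOR `C ≤ 1` THE EVERY-INSTANT ENSTROPHY FLOOR IS `4`.** A SINGULAR member of `𝒟_{C,K}` with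
Type-I constant `C ≤ 1` has `(√(√(−t)∫‖curl V(t)‖²dx)·(√K_S)³)⁴ ≥ 4`, i.e.
`∫‖ω(t)‖²dx ≥ 2K_S^{−3}/√(−t)`, at EVERY instant `t < 0` (the pure floor of
`…EveryInstant.vorticity_floor_of_singular` is `64/27 ≈ 2.37`). [folklore energy method] -/
theorem vorticity_floor_four_of_singular_of_typeI_le_one (hV : IsTypeIAncientMild C V) (hC1 : C ≤ 1)
    {K : ℝ}
    (hK : ∀ t : ℝ, t < 0 → ∫⁻ x, ‖fderiv ℝ (V t) x‖ₑ ^ 2 ≤ ENNReal.ofReal (K / Real.sqrt (-t)))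
    (hsing : ∀ r > 0, ∀ M : ℝ, ∃ t ∈ Set.Ioo (-(r ^ 2)) (0 : ℝ),
        ∃ x ∈ Metric.ball (0 : EuclideanSpace ℝ (Fin 3)) r, M < ‖V t x‖) {t : ℝ} (ht : t < 0) :
    4 ≤ (Real.sqrt (Real.sqrt (-t) * ∫ x, ‖curl (V t) x‖ ^ 2) * Real.sqrt (SNormLESNormFDerivOfEqConst (EuclideanSpace ℝ (Fin 3))
        (volume : Measure (EuclideanSpace ℝ (Fin 3))) 2 : ℝ) ^ 3) ^ 4 := by
  by_contra hlt
  push Not at hlt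
  set T : ℝ := (Real.sqrt (Real.sqrt (-t) * ∫ x, ‖curl (V t) x‖ ^ 2) * Real.sqrt (SNormLESNormFDerivOfEqConst (EuclideanSpace ℝ (Fin 3))
        (volume : Measure (EuclideanSpace ℝ (Fin 3))) 2 : ℝ) ^ 3) ^ 4
    with hTdef
  have hT0 : 0 ≤ T := by positivity
  -- weights for the target `max T 1 < 4`
  have hT' : max T 1 < 4 := max_lt hlt (by norm_num)
  obtain ⟨lam, μ, κ, δ, h0, h1, hμ, hκ, hδ, H1, H2⟩ :=
    exists_lens_weights_of_le_one hV.nonneg hC1 (le_trans hT0 (le_max_left _ _)) hT'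
  have hfloor := vorticity_lens_floor_of_singular hV hK hsing h0 h1 hμ hκ hδ H1 ht
  rw [← hTdef] at hfloor
  linarith

end Lens

end Summit.NavierStokesRegularity.NavierStokesRegularity.Theorems.FiniteDissipationLiouville.EveryInstantMixed

end
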